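import Summits.ResolutionOfSingularities.ResolutionOfSingularities.Theorems.PurelyInseparableDim4JumpLedgerAlong
import HarnessLib
import HarnessLib.Audit.Tags

/-!
# Purely inseparable hypersurfaces `z^p + F` — NO DOUBLE RISE ALONG ZIGZAGS (`e = 1`):
# two consecutive HP-regular rises of the shade force `|S₁| ≥ 5`
# [OURS · CANDIDATE · counted 0 · card I-9-2 of cell res-dim4-pi, hand proof PROOF-B]

Sequel of `PurelyInseparableDim4JumpLedgerAlong.lean` (same scope: HP-permissible coordinate centres,
points `b' + c` of a chart with `c` a point of the centre at which the shade does not jump).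

MODEL LEVEL (§1, any finite index type `σ`, order of record `q = p`, `e = 1`).  Let `t` be a clean state
(`F ≠ 0`, `y^r ∣ F`) and `(S₁ ∋ j₁, b₁)` a fibre point of an HP-permissible coordinate centre
((1) on the support, (2) per monomial) at which the shade RISES; let `s' := step p S₁ j₁ b₁ t`, and let
`t₂` be any clean state with `t₂.r = s'.r|_{c₂ = 0}` and `shade t₂ = shade s'` (the state `s'` MOVED to a
point `c₂` of a second centre `S₂` and re-cleaned, `c₂ = 0` on `S₂`, no shade jump at `c₂`) carrying its
own HP hypotheses for `(S₂ ∋ j₂, b₂)`; if the shade rises AGAIN at `(S₂, j₂, b₂)` from `t₂`, then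
`5 ≤ #S₁` (`five_le_card_of_rise_rise`).  MECHANISM (Hauser–Perlega's arithmetic used twice, every
ingredient a theorem of the tree): after rise 1 the components with `p ∤ r'` are exactly the kept,
untranslated centre components `≠ j₁` with `p ∤ r` ((b) + (7)); rise 2 needs two of them off the move
((d)); (2) at both rises gives `Σ_{lost} r + Σ_{dropped kept} r ≡ 1 (mod p)`; and (6) + (d) at rise 1
leave no room unless `#S₁ ≥ 5`.  The point form at `b₁' + c₁`, `b₂' + c₂` (`five_le_card_of_rise_rise_add`)
is the composition with brick PR-1 (`MohAlong.step_add_eq_step_translate_clean_one`,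
`JumpLedger.translate_hypotheses`).

CLASS `(4,1)` (§2, the cell's frame): two consecutive `Edge`s along centres with `IsPermissibleCentre` ∧
`Perm2` at their sources, the shade constant at the `K`-points of each centre (or just: no jump at the
centre part of each edge's point), the first RISE:d ⇒ the second is NOT RISE:d
(`not_riseD_of_riseD_of_edges`, `shade_le_of_riseD_piecewise`).

HONEST SCOPE.  For FIBRE points (`c = 0`) this is the `m = n + 2` case of Moh's `e = 1` stability, in the
tree for every number of variables (`CentreBlowup.shade_le_shade_add_one_along`); the content here is the
TRANSLATED case, where Moh's witness can be lost (`PurelyInseparableDim4MohAlongWitnessLoss.lean`) and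
no clause on the composite point / nesting / revisits is assumed.  Special points of a centre (shade
jump at `c`, (2) failing at `c`) are excluded per edge, exactly as in `JumpLedgerAlong`; `e = 1` only;
stalls between the two rises are not covered; in `≥ 5` variables nothing is claimed.  Resolution of
singularities in dimension ≥ 4 / characteristic `p` is NOT proved anywhere in this programme; counted 0;
AI formalisation, weaker than expert review.

(Landing note, typ-2 g2: idea-9 g2's file `NoDoubleRise.lean` 05896a07ea8a032e landed verbatim in two parts at its own
`section` seam — this file = §1 model level; `PurelyInseparableDim4NoDoubleRiseFrame.lean` = §2 the class-(4,1) frame;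
the one-line restatement `degree_eq_sum_univ` of Mathlib's `Finsupp.degree_eq_sum` was inlined (gate dedup).)

bears_on: LADDER-RESOLUTION:D157-DOOR2 (res-dim4-pi · I-9-2).
[cite: HauserPerlega2019PRIMS, §3 Theorem (2), (6), (7), Comments (b), (d)]
[cite: Moh1987, Stability Theorem (p. 966)]
-/

set_option linter.dupNamespace false

noncomputable section

open MvPolynomial Finset

open scoped BigOperators

namespace Summit.ResolutionOfSingularities.ResolutionOfSingularities.Theorems.PIDim4.NoDoubleRise

open Literature.AlgebraicGeometry.Resolution
open Literature.AlgebraicGeometry.Resolution.Hauser2010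
open Literature.AlgebraicGeometry.Resolution.CentreBlowup
open KangarooLoss MohAlong JumpLedger

/-! ## 1. Model level -/

section Core

variable {σ : Type*} {K : Type*} [Field K] [Fintype σ] [DecidableEq σ] [DecidableEq K]
variable (p : ℕ) [hp : Fact p.Prime] [CharP K p]

/-- **(7) at `e = 1`**: at a rise under an HP-permissible coordinate centre, `p ∣ r_i` off the centre.
[cite: HauserPerlega2019PRIMS, §3 Theorem (7)] -/
theorem dvd_r_of_not_mem {S : Finset σ} {j : σ} (hj : j ∈ S) (b : σ → K) (hbj : b j = 0)
    (hbN : ∀ i, i ∉ S → b i = 0) (t : CState σ K) {o : ℕ} (ho : ordZero t.F = o)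
    (hr : ∀ d ∈ t.F.support, t.r ≤ d) (hq : ∀ d ∈ t.F.support, p ≤ degIn S d)
    (hperm : ∀ d ∈ t.F.support, degIn S t.r + (o - t.r.degree) ≤ degIn S d)
    (hinc : ShadeIncreases p S j b t) {i : σ} (hi : i ∉ S) : p ∣ t.r i := by
  have hq1 : ∀ d ∈ t.F.support, p ^ 1 ≤ degIn S d := fun d hd => by rw [pow_one]; exact hq d hd
  have hinc1 : ShadeIncreases (p ^ 1) S j b t := by rw [pow_one]; exact hinc
  have h := pow_dvd_r_of_shadeIncreases_of_not_mem p hj b hbj hbN t ho hr hq1 hperm hinc1 hi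
  rwa [pow_one] at h

/-- **Claim A of PROOF-B**: after a rise at a fibre point of an HP-permissible coordinate centre, a
component with `p ∤ r′_i` is a KEPT, UNTRANSLATED centre component other than the chart's, and
`r′_i = r_i` with `p ∤ r_i`. [cite: HauserPerlega2019PRIMS, §3 Theorem (7), Comment (b)] -/
theorem mem_of_not_dvd_step_r {S : Finset σ} {j : σ} (hj : j ∈ S) (b : σ → K) (hbj : b j = 0)
    (hbN : ∀ i, i ∉ S → b i = 0) (t : CState σ K) {o : ℕ} (ho : ordZero t.F = o)
    (hr : ∀ d ∈ t.F.support, t.r ≤ d) (hq : ∀ d ∈ t.F.support, p ≤ degIn S d)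
    (hperm : ∀ d ∈ t.F.support, degIn S t.r + (o - t.r.degree) ≤ degIn S d)
    (hinc : ShadeIncreases p S j b t) {i : σ} (hi : ¬ p ∣ (step p S j b t).r i) :
    i ∈ S ∧ i ≠ j ∧ b i = 0 ∧ ¬ p ∣ t.r i ∧ (step p S j b t).r i = t.r i := by
  have hij : i ≠ j := by
    rintro rfl
    exact hi (dvd_step_r_self_of_shadeIncreases p hj b hbj hbN t ho hr hq hperm hinc)
  have hstep : (step p S j b t).r i = if b i = 0 then t.r i else 0 :=
    step_r_apply_of_ne' p S hij b t
  have hbi : b i = 0 := by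
    by_contra hbi
    rw [hstep, if_neg hbi] at hi
    exact hi (dvd_zero p)
  rw [hstep, if_pos hbi] at hi
  have hiS : i ∈ S := by
    by_contra hiS
    exact hi (dvd_r_of_not_mem p hj b hbj hbN t ho hr hq hperm hinc hiS)
  refine ⟨hiS, hij, hbi, hi, ?_⟩
  rw [hstep, if_pos hbi]

/-- The multiplicities `r′` after a rise, read modulo `p`: `r′_i ≡ r_i` on the kept untranslated
centre components `≠ j`, and `≡ 0` everywhere else. [cite: HauserPerlega2019PRIMS, §3 Theorem (7), Comment (b)] -/
theorem cast_step_r_apply {S : Finset σ} {j : σ} (hj : j ∈ S) (b : σ → K) (hbj : b j = 0)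
    (hbN : ∀ i, i ∉ S → b i = 0) (t : CState σ K) {o : ℕ} (ho : ordZero t.F = o)
    (hr : ∀ d ∈ t.F.support, t.r ≤ d) (hq : ∀ d ∈ t.F.support, p ≤ degIn S d)
    (hperm : ∀ d ∈ t.F.support, degIn S t.r + (o - t.r.degree) ≤ degIn S d)
    (hinc : ShadeIncreases p S j b t) (i : σ) :
    (((step p S j b t).r i : ℕ) : ZMod p) =
      if i ∈ S ∧ ¬ (i = j ∨ b i ≠ 0) then ((t.r i : ℕ) : ZMod p) else 0 := by
  by_cases hij : i = j
  · rw [if_neg (fun h => h.2 (Or.inl hij)), hij]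
    exact (ZMod.natCast_eq_zero_iff _ _).mpr
      (dvd_step_r_self_of_shadeIncreases p hj b hbj hbN t ho hr hq hperm hinc)
  · rw [step_r_apply_of_ne' p S hij b t]
    by_cases hbi : b i = 0
    · rw [if_pos hbi]
      by_cases hiS : i ∈ S
      · rw [if_pos ⟨hiS, fun h => h.elim hij (fun h' => h' hbi)⟩]
      · rw [if_neg (fun h => hiS h.1)]
        exact (ZMod.natCast_eq_zero_iff _ _).mpr
          (dvd_r_of_not_mem p hj b hbj hbN t ho hr hq hperm hinc hiS)
    · rw [if_neg hbi, Nat.cast_zero, if_neg (fun h => h.2 (Or.inr hbi))]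

/-- **Two consecutive HP-regular rises force `|S₁| ≥ 5`** (`e = 1`; model level, any number of
variables; the second edge read on the MOVED state `t₂` of `s' = step p S₁ j₁ b₁ t`:
`t₂.r = s'.r|_{c₂ = 0}`, `shade t₂ = shade s'` — here `c₂ : σ → K` is ARBITRARY: the set of components
dropped between the two rises may be any set).  See the module docstring; hand proof PROOF-B of
cell res-dim4-pi.  [cite: HauserPerlega2019PRIMS, §3 Theorem (2), (6), (7), Comments (b), (d)]
[cite: Moh1987, Stability Theorem (p. 966)] -/
theorem five_le_card_of_rise_rise {S₁ S₂ : Finset σ} {j₁ j₂ : σ} (hj₁ : j₁ ∈ S₁) (hj₂ : j₂ ∈ S₂)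
    (b₁ b₂ c₂ : σ → K) (hb₁j : b₁ j₁ = 0) (hb₁N : ∀ i, i ∉ S₁ → b₁ i = 0) (hb₂j : b₂ j₂ = 0)
    (hb₂N : ∀ i, i ∉ S₂ → b₂ i = 0)
    (t : CState σ K) (hclean : deletePthPowers p t.F = t.F) {o : ℕ} (ho : ordZero t.F = o)
    (hr : ∀ d ∈ t.F.support, t.r ≤ d) (hq : ∀ d ∈ t.F.support, p ≤ degIn S₁ d)
    (hperm : ∀ d ∈ t.F.support, degIn S₁ t.r + (o - t.r.degree) ≤ degIn S₁ d)
    (hinc : ShadeIncreases p S₁ j₁ b₁ t)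
    (t₂ : CState σ K) (ht₂r : t₂.r = (step p S₁ j₁ b₁ t).r.filter (fun i => c₂ i = 0))
    (ht₂sh : t₂.shade = (step p S₁ j₁ b₁ t).shade)
    (hclean₂ : deletePthPowers p t₂.F = t₂.F) {o₂ : ℕ} (ho₂ : ordZero t₂.F = o₂)
    (hr₂ : ∀ d ∈ t₂.F.support, t₂.r ≤ d) (hq₂ : ∀ d ∈ t₂.F.support, p ≤ degIn S₂ d)
    (hperm₂ : ∀ d ∈ t₂.F.support, degIn S₂ t₂.r + (o₂ - t₂.r.degree) ≤ degIn S₂ d)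
    (hinc₂ : ShadeIncreases p S₂ j₂ b₂ t₂) : 5 ≤ S₁.card := by
  have hp1 : 1 < p := hp.out.one_lt
  set s' : CState σ K := step p S₁ j₁ b₁ t with hs'
  -- the order of the new `F`
  have hF' : s'.F ≠ 0 := step_F_ne_zero p hj₁ b₁ hb₁j hb₁N t hclean ho hr hq
  obtain ⟨o', ho'⟩ := exists_ordZero_eq_natCast hF'
  obtain ⟨hpo, hpdeg, hro⟩ := le_of_forall_le_degIn S₁ t ho hr hperm hq
  obtain ⟨-, -, hro₂⟩ := le_of_forall_le_degIn S₂ t₂ ho₂ hr₂ hperm₂ hq₂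
  -- (2) at both rises
  have h2a : p ∣ o := dvd_of_shadeIncreases p hj₁ b₁ hb₁j hb₁N t ho hr hq hperm hinc
  have h2b : p ∣ o₂ := dvd_of_shadeIncreases p hj₂ b₂ hb₂j hb₂N t₂ ho₂ hr₂ hq₂ hperm₂ hinc₂
  -- Moh + rise 1: `shade s' = shade t + 1`; no jump: `shade t₂ = shade s'` (as naturals)
  have hMoh := mohBound_one p hj₁ b₁ hb₁j hb₁N t hclean ho hr hq hperm
  have hsh1 : o' - s'.r.degree = o - t.r.degree + 1 := by
    have h1 : t.shade < s'.shade := hinc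
    rw [CState.shade_eq_of_ordZero_eq t ho, CState.shade_eq_of_ordZero_eq s' ho'] at h1 hMoh
    have h1' : o - t.r.degree < o' - s'.r.degree := by exact_mod_cast h1
    have hM' : o' - s'.r.degree ≤ o - t.r.degree + 1 := by exact_mod_cast hMoh
    omega
  have hsh2 : o₂ - t₂.r.degree = o' - s'.r.degree := by
    have h := ht₂sh
    rw [CState.shade_eq_of_ordZero_eq t₂ ho₂, CState.shade_eq_of_ordZero_eq s' ho'] at h
    exact_mod_cast h
  -- the index sets
  set L : Finset σ := S₁.filter (fun i => i = j₁ ∨ b₁ i ≠ 0) with hL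
  set V : Finset σ := S₁.filter (fun i => ¬ (i = j₁ ∨ b₁ i ≠ 0)) with hV
  set A : Finset σ := L.filter (fun i => ¬ p ∣ t.r i) with hA
  set U : Finset σ := V.filter (fun i => ¬ p ∣ t.r i) with hU
  have hlost : PointBlowup.lostComponents j₁ b₁ = L := by
    ext i
    simp only [PointBlowup.lostComponents, Finset.mem_filter, Finset.mem_univ, true_and, hL]
    constructor
    · intro h
      refine ⟨?_, h⟩
      rcases h with h | h
      · exact h ▸ hj₁
      · by_contra hiS
        exact h (hb₁N i hiS)
    · exact fun h => h.2
  -- the sums modulo p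
  have hsum_t : ((t.r.degree : ℕ) : ZMod p) = ∑ i ∈ S₁, ((t.r i : ℕ) : ZMod p) := by
    rw [Finsupp.degree_eq_sum, Nat.cast_sum]
    rw [show (∑ i ∈ S₁, ((t.r i : ℕ) : ZMod p)) =
        ∑ i ∈ (Finset.univ.filter fun i => i ∈ S₁), ((t.r i : ℕ) : ZMod p) by
      congr 1; ext i; simp]
    rw [Finset.sum_filter]
    refine Finset.sum_congr rfl fun i _ => ?_
    by_cases hiS : i ∈ S₁
    · rw [if_pos hiS]
    · rw [if_neg hiS]
      exact (ZMod.natCast_eq_zero_iff _ _).mpr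
        (dvd_r_of_not_mem p hj₁ b₁ hb₁j hb₁N t ho hr hq hperm hinc hiS)
  have hsum_t₂ : ((t₂.r.degree : ℕ) : ZMod p) =
      ∑ i ∈ V.filter (fun i => c₂ i = 0), ((t.r i : ℕ) : ZMod p) := by
    rw [Finsupp.degree_eq_sum, Nat.cast_sum]
    rw [show (∑ i ∈ V.filter (fun i => c₂ i = 0), ((t.r i : ℕ) : ZMod p)) =
        ∑ i ∈ (Finset.univ.filter fun i => (i ∈ S₁ ∧ ¬ (i = j₁ ∨ b₁ i ≠ 0)) ∧ c₂ i = 0),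
          ((t.r i : ℕ) : ZMod p) by
      congr 1; ext i; simp [hV, and_assoc]]
    rw [Finset.sum_filter]
    refine Finset.sum_congr rfl fun i _ => ?_
    rw [ht₂r, Finsupp.filter_apply]
    by_cases hci : c₂ i = 0
    · rw [if_pos hci, cast_step_r_apply p hj₁ b₁ hb₁j hb₁N t ho hr hq hperm hinc i]
      by_cases hP : i ∈ S₁ ∧ ¬ (i = j₁ ∨ b₁ i ≠ 0)
      · rw [if_pos hP, if_pos ⟨hP, hci⟩]
      · rw [if_neg hP, if_neg (fun h => hP h.1)]
    · rw [if_neg hci, Nat.cast_zero, if_neg (fun h => hci h.2)]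
  have hsplit₁ : ∑ i ∈ S₁, ((t.r i : ℕ) : ZMod p) =
      ∑ i ∈ L, ((t.r i : ℕ) : ZMod p) + ∑ i ∈ V, ((t.r i : ℕ) : ZMod p) :=
    (Finset.sum_filter_add_sum_filter_not S₁ (fun i => i = j₁ ∨ b₁ i ≠ 0) _).symm
  have hsplit₂ : ∑ i ∈ V, ((t.r i : ℕ) : ZMod p) =
      ∑ i ∈ V.filter (fun i => c₂ i = 0), ((t.r i : ℕ) : ZMod p) +
        ∑ i ∈ V.filter (fun i => ¬ c₂ i = 0), ((t.r i : ℕ) : ZMod p) :=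
    (Finset.sum_filter_add_sum_filter_not V (fun i => c₂ i = 0) _).symm
  -- the key congruence: `Σ_{lost} r + Σ_{kept, dropped by the move} r ≡ 1 (mod p)`
  have hkey : ∑ i ∈ L, ((t.r i : ℕ) : ZMod p) +
      ∑ i ∈ V.filter (fun i => ¬ c₂ i = 0), ((t.r i : ℕ) : ZMod p) = 1 := by
    have e1 : o = t.r.degree + (o - t.r.degree) := by omega
    have e2 : o₂ = t₂.r.degree + (o - t.r.degree) + 1 := by omega
    have z1 : ((o : ℕ) : ZMod p) = 0 := (ZMod.natCast_eq_zero_iff _ _).mpr h2a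
    have z2 : ((o₂ : ℕ) : ZMod p) = 0 := (ZMod.natCast_eq_zero_iff _ _).mpr h2b
    rw [e1, Nat.cast_add, hsum_t, hsplit₁, hsplit₂] at z1
    rw [e2, Nat.cast_add, Nat.cast_add, hsum_t₂, Nat.cast_one] at z2
    linear_combination z1 - z2
  -- (6) and (d) at rise 1
  have hq1 : ∀ d ∈ t.F.support, p ^ 1 ≤ degIn S₁ d := fun d hd => by rw [pow_one]; exact hq d hd
  have hclean1 : deletePthPowers (p ^ 1) t.F = t.F := by rw [pow_one]; exact hclean
  have hinc1 : ShadeIncreases (p ^ 1) S₁ j₁ b₁ t := by rw [pow_one]; exact hinc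
  have h6 := residueInequality_of_shadeIncreases_of_clean p (le_refl 1) hj₁ b₁ hb₁j hb₁N t hclean1
    ho hr hq1 hperm hinc1
  unfold HauserPerlega2019.ResidueInequality at h6
  simp only [show (1 : ℕ) - 1 + 1 = 1 from rfl, pow_one, hlost] at h6
  -- h6 : ((∑ i ∈ L, t.r i % p : ℕ) : ℤ) ≤ ((A.card : ℤ) - 1) * p
  obtain ⟨i₁, i₂, hne, hl₁, hl₂, hnd₁, hnd₂⟩ :=
    exists_two_lost_of_shadeIncreases p (le_refl 1) hj₁ b₁ hb₁j hb₁N t hclean1 ho hr hq1 hperm hinc1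
  rw [pow_one] at hnd₁ hnd₂
  have hmemL : ∀ i, (i = j₁ ∨ b₁ i ≠ 0) → i ∈ L := fun i h => by
    rw [← hlost]
    exact Finset.mem_filter.mpr ⟨Finset.mem_univ _, h⟩
  have hA2 : 1 < A.card := Finset.one_lt_card.mpr
    ⟨i₁, Finset.mem_filter.mpr ⟨hmemL i₁ hl₁, hnd₁⟩, i₂, Finset.mem_filter.mpr ⟨hmemL i₂ hl₂, hnd₂⟩, hne⟩
  -- the residues of the lost components: `A.card ≤ Σ_{L} (r mod p) ≤ (A.card - 1)·p`
  set ρ : ℕ := ∑ i ∈ L, t.r i % p with hρ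
  have hρ_ge : A.card ≤ ρ := by
    have h1 : A.card • 1 ≤ ∑ i ∈ A, t.r i % p :=
      Finset.card_nsmul_le_sum A (fun i => t.r i % p) 1 fun i hi => by
        have hnd : ¬ p ∣ t.r i := (Finset.mem_filter.mp hi).2
        have : t.r i % p ≠ 0 := fun h => hnd (Nat.dvd_of_mod_eq_zero h)
        omega
    have h2 : ∑ i ∈ A, t.r i % p ≤ ∑ i ∈ L, t.r i % p :=
      Finset.sum_le_sum_of_subset (Finset.filter_subset _ L)
    rw [smul_eq_mul, mul_one] at h1
    omega
  have hρ_le : (ρ : ℤ) ≤ ((A.card : ℤ) - 1) * p := h6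
  have hρ_cast : ((ρ : ℕ) : ZMod p) = ∑ i ∈ L, ((t.r i : ℕ) : ZMod p) := by
    rw [hρ, Nat.cast_sum]
    exact Finset.sum_congr rfl fun i _ => ZMod.natCast_mod _ _
  -- (d) at rise 2: two kept non-divisible components off the move
  obtain ⟨k₁, k₂, hkne, -, -, hknd₁, hknd₂⟩ :=
    exists_two_lost_of_shadeIncreases p (le_refl 1) hj₂ b₂ hb₂j hb₂N t₂ (by rw [pow_one]; exact hclean₂)
      ho₂ hr₂ (fun d hd => by rw [pow_one]; exact hq₂ d hd) hperm₂ (by rw [pow_one]; exact hinc₂)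
  rw [pow_one] at hknd₁ hknd₂
  have hkept : ∀ k, ¬ p ∣ t₂.r k → k ∈ U ∧ c₂ k = 0 := by
    intro k hk
    rw [ht₂r, Finsupp.filter_apply] at hk
    by_cases hck : c₂ k = 0
    · rw [if_pos hck] at hk
      obtain ⟨hkS, hkj, hbk, hndk, -⟩ := mem_of_not_dvd_step_r p hj₁ b₁ hb₁j hb₁N t ho hr hq hperm hinc hk
      refine ⟨Finset.mem_filter.mpr ⟨Finset.mem_filter.mpr ⟨hkS, ?_⟩, hndk⟩, hck⟩
      push Not
      exact ⟨hkj, hbk⟩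
    · rw [if_neg hck] at hk
      exact (hk (dvd_zero p)).elim
  obtain ⟨hk₁U, hck₁⟩ := hkept k₁ hknd₁
  obtain ⟨hk₂U, hck₂⟩ := hkept k₂ hknd₂
  have hU2 : 1 < U.card := Finset.one_lt_card.mpr ⟨k₁, hk₁U, k₂, hk₂U, hkne⟩
  -- A and U are disjoint subsets of S₁
  have hAS : A ⊆ S₁ := (Finset.filter_subset _ L).trans (Finset.filter_subset _ S₁)
  have hUS : U ⊆ S₁ := (Finset.filter_subset _ V).trans (Finset.filter_subset _ S₁)
  have hdisj : Disjoint A U := by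
    rw [Finset.disjoint_left]
    intro i hiA hiU
    have h1 := (Finset.mem_filter.mp (Finset.mem_filter.mp hiA).1).2
    have h2 := (Finset.mem_filter.mp (Finset.mem_filter.mp hiU).1).2
    exact h2 h1
  have hcard : A.card + U.card ≤ S₁.card := by
    rw [← Finset.card_union_of_disjoint hdisj]
    exact Finset.card_le_card (Finset.union_subset hAS hUS)
  -- case analysis on the kept components dropped by the move
  by_cases hδ : ∀ i ∈ V.filter (fun i => ¬ c₂ i = 0), p ∣ t.r i
  · -- no non-divisible kept component is dropped: `Σ_L r ≡ 1`, so three lost residues are needed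
    have hz : ∑ i ∈ V.filter (fun i => ¬ c₂ i = 0), ((t.r i : ℕ) : ZMod p) = 0 :=
      Finset.sum_eq_zero fun i hi => (ZMod.natCast_eq_zero_iff _ _).mpr (hδ i hi)
    rw [hz, add_zero, ← hρ_cast] at hkey
    have hmod : ρ % p = 1 := by
      have h := (ZMod.natCast_eq_natCast_iff' ρ 1 p).mp (by rw [Nat.cast_one]; exact hkey)
      rwa [Nat.mod_eq_of_lt hp1] at h
    have hA3 : 2 < A.card := by
      by_contra hA3
      have hA2' : A.card = 2 := by omega
      have hρp : ρ ≤ p := by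
        have h : (ρ : ℤ) ≤ ((2 : ℕ) - 1 : ℤ) * p := by rw [← hA2']; exact_mod_cast hρ_le
        push_cast at h
        linarith
      rcases Nat.lt_or_ge ρ p with hlt | hge
      · rw [Nat.mod_eq_of_lt hlt] at hmod
        omega
      · have hρeq : ρ = p := le_antisymm hρp hge
        rw [hρeq, Nat.mod_self] at hmod
        omega
    omega
  · -- a non-divisible kept component is dropped by the move: it is a third element of U
    push Not at hδ
    obtain ⟨i, hiV, hind⟩ := hδ
    obtain ⟨hiV', hci⟩ := Finset.mem_filter.mp hiV
    have hiU : i ∈ U := Finset.mem_filter.mpr ⟨hiV', hind⟩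
    have hU3 : 2 < U.card := Finset.two_lt_card.mpr
      ⟨i, hiU, k₁, hk₁U, k₂, hk₂U, fun h => hci (h ▸ hck₁), fun h => hci (h ▸ hck₂), hkne⟩
    omega

/-- **Point form at `b₁' + c₁`, `b₂' + c₂`** (the composition with brick PR-1).  `e = 1`, any finite
index type: `s` clean (`F ≠ 0`, `y^r ∣ F`), centre `S₁ ∋ j₁` with (1) on the support and (2) at the
origin, chart point `b₁' + c₁` (`b₁'` in the fibre, `c₁` on the centre) with NO shade jump at `c₁`
and a RISE; then centre `S₂ ∋ j₂` with (1) ∧ (2) for `s' := step p S₁ j₁ (b₁' + c₁) s`, chart point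
`b₂' + c₂` with no shade jump at `c₂` and a second RISE ⇒ `5 ≤ #S₁`.
[cite: HauserPerlega2019PRIMS, §3 Theorem (2), (6), (7), Comments (b), (d)] [cite: Moh1987, Stability Theorem (p. 966)] -/
theorem five_le_card_of_rise_rise_add {S₁ S₂ : Finset σ} {j₁ j₂ : σ} (hj₁ : j₁ ∈ S₁)
    (hj₂ : j₂ ∈ S₂) (b₁ c₁ b₂ c₂ : σ → K) (hb₁j : b₁ j₁ = 0) (hb₁N : ∀ i, i ∉ S₁ → b₁ i = 0)
    (hc₁ : ∀ i ∈ S₁, c₁ i = 0) (hb₂j : b₂ j₂ = 0) (hb₂N : ∀ i, i ∉ S₂ → b₂ i = 0)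
    (hc₂ : ∀ i ∈ S₂, c₂ i = 0) (s : CState σ K) (hclean : deletePthPowers p s.F = s.F)
    (hF : s.F ≠ 0) (hr : ∀ d ∈ s.F.support, s.r ≤ d) (hq : ∀ d ∈ s.F.support, p ≤ degIn S₁ d)
    (hperm : ((degIn S₁ s.r : ℕ) : ℕ∞) + s.shade ≤ ordAlong S₁ s.F)
    (heq : CState.shade ⟨deletePthPowers p (PointBlowup.translate c₁ s.F),
        s.r.filter (fun i => c₁ i = 0), s.exc.filter (fun i => c₁ i = 0)⟩ = s.shade)
    (hinc : s.shade < (step p S₁ j₁ (b₁ + c₁) s).shade)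
    (hq₂ : ∀ d ∈ (step p S₁ j₁ (b₁ + c₁) s).F.support, p ≤ degIn S₂ d)
    (hperm₂ : ((degIn S₂ (step p S₁ j₁ (b₁ + c₁) s).r : ℕ) : ℕ∞) +
        (step p S₁ j₁ (b₁ + c₁) s).shade ≤ ordAlong S₂ (step p S₁ j₁ (b₁ + c₁) s).F)
    (heq₂ : CState.shade ⟨deletePthPowers p (PointBlowup.translate c₂ (step p S₁ j₁ (b₁ + c₁) s).F),
        (step p S₁ j₁ (b₁ + c₁) s).r.filter (fun i => c₂ i = 0),
        (step p S₁ j₁ (b₁ + c₁) s).exc.filter (fun i => c₂ i = 0)⟩ =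
        (step p S₁ j₁ (b₁ + c₁) s).shade)
    (hinc₂ : (step p S₁ j₁ (b₁ + c₁) s).shade <
        (step p S₂ j₂ (b₂ + c₂) (step p S₁ j₁ (b₁ + c₁) s)).shade) : 5 ≤ S₁.card := by
  -- edge 1: the step at `b₁ + c₁` is the fibre step of the moved state `M`
  obtain ⟨oM, hoM⟩ := exists_ordZero_eq_natCast (clean_translate_ne_zero p c₁ hclean hF)
  obtain ⟨hcleanM, hrM, hqM, hpermM⟩ := translate_hypotheses p c₁ hc₁ s hclean hr hq hperm heq hoM
  have hstep₁ := step_add_eq_step_translate_clean_one p hj₁ b₁ c₁ hb₁N hc₁ s hclean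
  rw [hstep₁] at hinc hq₂ hperm₂ heq₂ hinc₂
  set M : CState σ K := ⟨deletePthPowers p (PointBlowup.translate c₁ s.F),
    s.r.filter (fun i => c₁ i = 0), s.exc.filter (fun i => c₁ i = 0)⟩ with hM
  have hincM : ShadeIncreases p S₁ j₁ b₁ M := by
    unfold ShadeIncreases
    rw [heq]
    exact hinc
  -- the new state `s'` and its hypotheses
  set s' : CState σ K := step p S₁ j₁ b₁ M with hs'
  have hclean' : deletePthPowers p s'.F = s'.F := deletePthPowers_step p S₁ j₁ b₁ M
  have hF' : s'.F ≠ 0 := step_F_ne_zero p hj₁ b₁ hb₁j hb₁N M hcleanM hoM hrM hqM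
  have hr' : ∀ d ∈ s'.F.support, s'.r ≤ d := newMult_le_of_mem_support_step p S₁ j₁ b₁ hb₁j M hoM hrM hpermM
  -- edge 2: the step at `b₂ + c₂` is the fibre step of the moved state `M₂`
  obtain ⟨o₂, ho₂⟩ := exists_ordZero_eq_natCast (clean_translate_ne_zero p c₂ hclean' hF')
  obtain ⟨hcleanM₂, hrM₂, hqM₂, hpermM₂⟩ :=
    translate_hypotheses p c₂ hc₂ s' hclean' hr' hq₂ hperm₂ heq₂ ho₂
  have hstep₂ := step_add_eq_step_translate_clean_one p hj₂ b₂ c₂ hb₂N hc₂ s' hclean'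
  rw [hstep₂] at hinc₂
  set M₂ : CState σ K := ⟨deletePthPowers p (PointBlowup.translate c₂ s'.F),
    s'.r.filter (fun i => c₂ i = 0), s'.exc.filter (fun i => c₂ i = 0)⟩ with hM₂
  have hincM₂ : ShadeIncreases p S₂ j₂ b₂ M₂ := by
    unfold ShadeIncreases
    rw [heq₂]
    exact hinc₂
  exact five_le_card_of_rise_rise p hj₁ hj₂ b₁ b₂ c₂ hb₁j hb₁N hb₂j hb₂N M hcleanM hoM hrM hqM
    hpermM hincM M₂ rfl heq₂ hcleanM₂ ho₂ hrM₂ hqM₂ hpermM₂ hincM₂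

end Core

end Summit.ResolutionOfSingularities.ResolutionOfSingularities.Theorems.PIDim4.NoDoubleRise

end
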